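import Mathlib
import Summits.NavierStokesRegularity.NavierStokesRegularity.Theorems.FilamentSkeletonRssStadiumBilinearUnitSpeed
import Summits.NavierStokesRegularity.NavierStokesRegularity.Theorems.FilamentSkeletonRssStadiumTwoConstants

/-!
# Route `FilamentSkeletonRss` · child crux `TangentSkeletonNearStraightL` (stmt-NavierStokesRegularity-23320) · registered line
# `child_tangent_analytic_strip_L` (b0b56c52900dd90a), stub `stub_stripPropagation` — brick: THE TANGENT MODULUS IN THE STADIUM

Assembly of `Theorems.StadiumBilinearUnitSpeed.deriv_eq_tangent_of_eqOn_real` (p816983) and `Theorems.StadiumTwoConstants.two_constants_rectangle_vec`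
(p817215/p817238) in the stub's own terms: for a STADIUM-ANALYTIC CURVE (`F` complex-differentiable on the stadium
`{|Im z| < hs, |Re z − cc| < L + hs}`, `F t = cplx (X t)` at its real points, `‖F′‖ ≤ 2`) over a near-straight unit-speed curve `X`
(`‖X′‖ = 1`, tangent oscillation `‖X′(τ) − X′(σ)‖ ≤ Rb`), the analytic tangent stays near the real tangent at `cc` on every closed upper
rectangle `[cc−ℓ, cc+ℓ] × [0, H]` inside the stadium (`ℓ < L + hs`, `H < hs`):
`‖F′(z) − cplx(X′(cc))‖ ≤ Rb^{1−Im z/H} · 3^{Im z/H} · exp(δ·cosh(π(Re z−cc)/(2H))·cos(π Im z/(2H)))` whenever `log(3/Rb) ≤ δ·cosh(πℓ/(2H))`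
(`tangent_modulus_upper`).  This `η`-bound is the input of `Theorems.StadiumChord.chord_sq_re_ge_of_near_const` (p817277): the complexified chord
has `Re ≥ (1 − 6η²)s²`, i.e. the matched kernel is on its principal branch near the diagonal when `η < 1/√6`.
(The lower half `Im z ≤ 0` is the same statement for the reflected curve `conj ∘ F ∘ conj`; not spelled out.)
HONEST FRAMING: a brick for a plan about a HYPOTHETICAL filament skeleton on the NEGATIVE side of a MODEL route; the stub `stub_stripPropagation` is
NOT closed; nothing here bears on Navier–Stokes regularity or blow-up.  `--supports stmt-NavierStokesRegularity-23320`.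
-/

set_option linter.dupNamespace false

noncomputable section

namespace Summit.NavierStokesRegularity.NavierStokesRegularity.Theorems.StadiumTangentModulus

open Set Filter Topology Complex
open scoped InnerProductSpace

/-- The complexified real vector `(⟪v, eᵢ⟫)ᵢ` has sup norm at most `‖v‖`. [folklore] -/
theorem norm_cplx_le (v : EuclideanSpace ℝ (Fin 3)) :
    ‖(fun i => ((⟪v, EuclideanSpace.single i (1:ℝ)⟫_ℝ : ℝ) : ℂ))‖ ≤ ‖v‖ := by
  refine (pi_norm_le_iff_of_nonneg (norm_nonneg v)).2 fun i => ?_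
  rw [EuclideanSpace.inner_single_right, Complex.norm_real]
  simpa using PiLp.norm_apply_le v i

/-- **Tangent modulus on an upper rectangle of the stadium.**  See the module docstring. [folklore] -/
theorem tangent_modulus_upper {hs L cc Rb H ℓ δ : ℝ} (hhs : 0 < hs) (hRb : 0 < Rb) (hRb3 : Rb ≤ 3)
    (hH : 0 < H) (hHhs : H < hs) (hℓ : 0 < ℓ) (hℓ' : ℓ < L + hs) (hδ : 0 ≤ δ)
    {F : ℂ → (Fin 3 → ℂ)} (hF : DifferentiableOn ℂ F {z : ℂ | |z.im| < hs ∧ |z.re - cc| < L + hs})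
    (hFb : ∀ z ∈ {z : ℂ | |z.im| < hs ∧ |z.re - cc| < L + hs}, ‖deriv F z‖ ≤ 2)
    {X : ℝ → EuclideanSpace ℝ (Fin 3)} (hX : Differentiable ℝ X)
    (hFX : ∀ t : ℝ, (t : ℂ) ∈ {z : ℂ | |z.im| < hs ∧ |z.re - cc| < L + hs} →
      F t = fun i => ((⟪X t, EuclideanSpace.single i (1:ℝ)⟫_ℝ : ℝ) : ℂ))
    (hunit : ∀ t, ‖deriv X t‖ = 1) (hosc : ∀ τ σ, ‖deriv X τ - deriv X σ‖ ≤ Rb)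
    (hend : Real.log (3 / Rb) ≤ δ * Real.cosh (Real.pi / (2 * H) * ℓ)) :
    ∀ z : ℂ, |z.re - cc| ≤ ℓ → 0 ≤ z.im → z.im ≤ H →
      ‖deriv F z - fun i => ((⟪deriv X cc, EuclideanSpace.single i (1:ℝ)⟫_ℝ : ℝ) : ℂ)‖ ≤
        Rb ^ (1 - z.im / H) * 3 ^ (z.im / H) *
          Real.exp (δ * (Real.cosh (Real.pi / (2 * H) * (z.re - cc)) * Real.cos (Real.pi / (2 * H) * z.im))) := by
  set S : Set ℂ := {z : ℂ | |z.im| < hs ∧ |z.re - cc| < L + hs} with hSdef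
  set c0 : Fin 3 → ℂ := fun i => ((⟪deriv X cc, EuclideanSpace.single i (1:ℝ)⟫_ℝ : ℝ) : ℂ) with hc0
  -- the stadium is open
  have hSo : IsOpen S := by
    have h1 : IsOpen {z : ℂ | |z.im| < hs} := isOpen_lt (continuous_abs.comp Complex.continuous_im) continuous_const
    have h2 : IsOpen {z : ℂ | |z.re - cc| < L + hs} :=
      isOpen_lt (continuous_abs.comp (Complex.continuous_re.sub continuous_const)) continuous_const
    exact h1.inter h2
  have hdF : DifferentiableOn ℂ (deriv F) S := ((hF.analyticOnNhd hSo).deriv).differentiableOn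
  -- the translated rectangle and the function `φ w = F′(w + cc) − c0`
  set R : Set ℂ := Set.Ioo (-ℓ) ℓ ×ℂ Set.Ioo 0 H with hRdef
  have hcl : closure R = Set.Icc (-ℓ) ℓ ×ℂ Set.Icc 0 H := by
    rw [hRdef, closure_reProdIm, closure_Ioo (by linarith : (-ℓ) ≠ ℓ), closure_Ioo hH.ne]
  have hclS : ∀ w ∈ closure R, w + (cc : ℂ) ∈ S := by
    intro w hw
    rw [hcl] at hw
    obtain ⟨hx, hy⟩ := mem_reProdIm.1 hw
    refine ⟨?_, ?_⟩
    · show |(w + (cc : ℂ)).im| < hs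
      rw [Complex.add_im, Complex.ofReal_im, add_zero, abs_lt]
      constructor <;> linarith [hy.1, hy.2]
    · show |(w + (cc : ℂ)).re - cc| < L + hs
      rw [Complex.add_re, Complex.ofReal_re, add_sub_cancel_right, abs_lt]
      constructor <;> linarith [hx.1, hx.2]
  set φ : ℂ → (Fin 3 → ℂ) := fun w => deriv F (w + (cc : ℂ)) - c0 with hφdef
  have hφd : DifferentiableOn ℂ φ (closure R) := by
    have h1 : DifferentiableOn ℂ (fun w : ℂ => deriv F (w + (cc : ℂ))) (closure R) :=
      hdF.comp (by fun_prop) fun w hw => hclS w hw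
    exact h1.sub_const c0
  have hφ : DiffContOnCl ℂ φ R := hφd.diffContOnCl
  -- `‖c0‖ ≤ 1`
  have hc0n : ‖c0‖ ≤ 1 := by
    have h := norm_cplx_le (deriv X cc)
    rw [hunit cc] at h
    exact h
  -- `‖φ‖ ≤ 3` on the closed rectangle
  have hM : ∀ w ∈ closure R, ‖φ w‖ ≤ 3 := by
    intro w hw
    calc ‖φ w‖ ≤ ‖deriv F (w + (cc : ℂ))‖ + ‖c0‖ := norm_sub_le _ _
      _ ≤ 2 + 1 := add_le_add (hFb _ (hclS w hw)) hc0n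
      _ = 3 := by norm_num
  -- `‖φ‖ ≤ Rb` on the real base: there `F′ = cplx X′`
  set ℓ₁ : ℝ := (ℓ + (L + hs)) / 2 with hℓ₁
  have hℓ₁a : ℓ < ℓ₁ := by rw [hℓ₁]; linarith
  have hℓ₁b : ℓ₁ < L + hs := by rw [hℓ₁]; linarith
  have hsub : ∀ t : ℝ, t ∈ Set.Icc (cc - ℓ₁) (cc + ℓ₁) → (t : ℂ) ∈ S := by
    intro t ht
    refine ⟨by simpa using hhs, ?_⟩
    show |(t : ℂ).re - cc| < L + hs
    rw [Complex.ofReal_re, abs_lt]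
    constructor <;> linarith [ht.1, ht.2]
  have htan := Summit.NavierStokesRegularity.NavierStokesRegularity.Theorems.StadiumBilinearUnitSpeed.deriv_eq_tangent_of_eqOn_real
    hSo hF (a := cc - ℓ₁) (b := cc + ℓ₁) hsub (fun t ht => hFX t (hsub t ht)) (fun t _ => hX t)
  have hreal : ∀ x : ℝ, x ∈ Set.Icc (-ℓ) ℓ → ‖φ x‖ ≤ Rb := by
    intro x hx
    have hmem : x + cc ∈ Set.Ioo (cc - ℓ₁) (cc + ℓ₁) := by
      constructor <;> linarith [hx.1, hx.2]
    have h1 : deriv F ((x : ℂ) + (cc : ℂ)) = fun i => ((⟪deriv X (x + cc), EuclideanSpace.single i (1:ℝ)⟫_ℝ : ℝ) : ℂ) := by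
      rw [← Complex.ofReal_add]; exact htan (x + cc) hmem
    have h2 : φ x = fun i => ((⟪deriv X (x + cc) - deriv X cc, EuclideanSpace.single i (1:ℝ)⟫_ℝ : ℝ) : ℂ) := by
      simp only [hφdef, h1, hc0]
      funext i
      rw [inner_sub_left, Complex.ofReal_sub]
      rfl
    rw [h2]
    exact (norm_cplx_le _).trans (hosc _ _)
  -- two-constants, vector-valued
  have htwo := Summit.NavierStokesRegularity.NavierStokesRegularity.Theorems.StadiumTwoConstants.two_constants_rectangle_vec
    (Φ := φ) hℓ hH hRb hRb3 hδ hφ hM hreal hend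
  intro z hzre hzim0 hzimH
  have hw : z - (cc : ℂ) ∈ closure R := by
    rw [hcl]
    refine mem_reProdIm.2 ⟨?_, ?_⟩
    · rw [Complex.sub_re, Complex.ofReal_re]; exact abs_le.1 hzre
    · rw [Complex.sub_im, Complex.ofReal_im, sub_zero]; exact ⟨hzim0, hzimH⟩
  have h := htwo (z - (cc : ℂ)) hw
  have hφz : φ (z - (cc : ℂ)) = deriv F z - c0 := by simp only [hφdef, sub_add_cancel]
  rw [hφz, Complex.sub_re, Complex.ofReal_re, Complex.sub_im, Complex.ofReal_im, sub_zero] at h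
  exact h

end Summit.NavierStokesRegularity.NavierStokesRegularity.Theorems.StadiumTangentModulus

end
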